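import Mathlib
import Summits.NavierStokesRegularity.NavierStokesRegularity.Theorems.FilamentSkeletonRssTangentSkeletonNearStraightLSwirlBandDecoupling
import Summits.NavierStokesRegularity.NavierStokesRegularity.Theorems.FilamentSkeletonRssTangentSkeletonNearStraightLSwirlBandOdd

/-!
# Swirl-band decoupling, KERNEL-GRADIENT entries: `∫ cos(kσ)(σ²+D²)^{-5/2} dσ = (4/3)D⁻⁴·(C + pE)(k²D²/4) ≤ (4/3)D⁻⁴(1+kD/2)(1+kD)e^{−kD}`
# (`TangentSkeletonNearStraightL`, stmt-NavierStokesRegularity-23320; companion of (R♯-sw) `SwirlBandDecouplingL`)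

The coupling block `B = −P_n∇u_k·Y` of the linearised tangency operator (crux strategist, `Cruxes/SkeletonJ1L/STRATEGY-CENSUS.md`
PART III) differentiates the matched partner kernel once, so its entries carry the power `((d²+σ²)+μ²)^{−5/2}` (times `1, σ, σ²`).
After the even `(·)^{−3/2}` symbol (p826065, `2kK₁(kD)/D`) and the odd one (p826156, `kK₀(kD)`·const), this file treats the
order-`5/2` cosine symbol, classically `(2/3)k²K₂(kD)/D²`; in the tree's vocabulary (`Numerics.Cint p = 2√pK₁(2√p)`,
`Numerics.Eint p = 2K₀(2√p)`) it proves, def-free: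

* `integral_mul_fC_eq` : the first-moment identity `∫₀^∞ t e^{−t}e^{−p/t} dt = C(p) + p·E(p)` (`p > 0`; exact derivative of
  `t e^{−t}e^{−p/t}`, FTC on `(0,∞)`) — the Bessel recurrence `zK₂ = zK₀ + 2K₁` in disguise;
* `inv_rpow_five_halves_eq_integral`, `Gamma_five_halves` : Γ(5/2)-subordination of `(1+h²)^{−5/2}`;
* `integral_cos_mul_inv_rpow_five_halves` : `∫_ℝ cos(xh)(1+h²)^{−5/2} dh = (4/3)∫₀^∞ t e^{−t}e^{−x²/(4t)} dt` (Fubini + Gaussian);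
* `abs_integral_cos_mul_inv_rpow_five_halves_le` : `… ≤ (4/3)(1 + x/2)(1 + x)e^{−x}` for `x ≥ 0` (via `√pE ≤ C`, p826156, and
  `Cint_le_sharp`, p825980);
* `swirlBand_decoupling_grad` : for `0 < μ ≤ d`, `k ≥ 0`,
  `|∫ cos(kσ)((d²+σ²)+μ²)^{−5/2} dσ| ≤ (4/3)((d²+μ²)²)⁻¹(1 + k√(d²+μ²)/2)(1 + k√(d²+μ²))e^{−k√(d²+μ²)}`;
  the `σ²`-weighted entries follow by `σ²(·)^{−5/2} = (·)^{−3/2} − (d²+μ²)(·)^{−5/2}`.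

Together with p826065/p826156: every entry of the partner block's symbol up to one kernel derivative is `≤ poly(kD)·e^{−kD}` — the
swirl band `k ≥ μ⁻¹` of the coupled linearised operator is single-filament up to `e^{−d/μ} ≤ e^{−ρ√Γ/μ}` errors.  (The odd order-5/2
entry `∫₀^∞ σ sin(kσ)(·)^{−5/2} = (k/3)·` even order-3/2 symbol is an integration by parts away and is not repeated here.)
HONEST FRAMING: MODEL-level lemmas of the linear theory of a HYPOTHETICAL filament skeleton on the NEGATIVE side of a MODEL route;
no registered stub of 23320 is proved, `TangentSkeletonNearStraightL` stays OPEN, nothing here bears on Navier–Stokes regularity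
or blow-up.  `--supports stmt-NavierStokesRegularity-23320`.
-/

set_option linter.dupNamespace false

noncomputable section

open Real Set MeasureTheory Filter Topology

namespace Summit.NavierStokesRegularity.NavierStokesRegularity.Theorems.TangentSkeletonNearStraightLSwirlBand

open Summit.NavierStokesRegularity.NavierStokesRegularity.Theorems.AnalyticStripLiaSymbol
open Summit.NavierStokesRegularity.NavierStokesRegularity.Theorems.AnalyticStripLiaSymbol.Numerics

/-! ## §1  The first moment `∫₀^∞ t·e^{−t}e^{−p/t} dt = C(p) + p·E(p)` (i.e. `2pK₂ = 2√pK₁ + 2pK₀`) -/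

/-- Integrability of `t·e^{−t}e^{−p/t}` on `(0,∞)` (`≤ t e^{−t}`). [folklore] -/
theorem integrableOn_mul_fC {p : ℝ} (hp : 0 ≤ p) :
    IntegrableOn (fun t : ℝ => t * (Real.exp (-t) * Real.exp (-(p / t)))) (Ioi 0) := by
  have hG := Real.GammaIntegral_convergent (s := 2) (by norm_num)
  have hG' : IntegrableOn (fun t : ℝ => Real.exp (-t) * t) (Ioi 0) := by
    refine hG.congr_fun (fun t (_ : 0 < t) => ?_) measurableSet_Ioi
    simp only [show (2:ℝ) - 1 = 1 by norm_num, Real.rpow_one]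
  refine hG'.mono' (by fun_prop) ?_
  rw [ae_restrict_iff' measurableSet_Ioi]
  refine Filter.Eventually.of_forall fun t (ht : 0 < t) => ?_
  have h1 : Real.exp (-(p / t)) ≤ 1 := by rw [Real.exp_le_one_iff]; exact neg_nonpos.mpr (div_nonneg hp ht.le)
  rw [Real.norm_eq_abs, abs_of_nonneg (by positivity)]
  calc t * (Real.exp (-t) * Real.exp (-(p / t))) ≤ t * (Real.exp (-t) * 1) := by gcongr
    _ = Real.exp (-t) * t := by ring

/-- **First-moment identity** `∫₀^∞ t·e^{−t}e^{−p/t} dt = C(p) + p·E(p)` for `p > 0`: the exact derivative of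
`F(t) = t·e^{−t}e^{−p/t}` is `e^{−t}e^{−p/t}·(1 − t + p/t)` and `F(0⁺) = F(∞) = 0`. [folklore] -/
theorem integral_mul_fC_eq {p : ℝ} (hp : 0 < p) :
    ∫ t in Ioi (0:ℝ), t * (Real.exp (-t) * Real.exp (-(p / t))) = Cint p + p * Eint p := by
  -- derivative of F
  have hderiv : ∀ t ∈ Ioi (0:ℝ), HasDerivAt (fun t : ℝ => t * (Real.exp (-t) * Real.exp (-(p / t))))
      ((Real.exp (-t) * Real.exp (-(p / t)) - t * (Real.exp (-t) * Real.exp (-(p / t))))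
        + p * (Real.exp (-t) * Real.exp (-(p / t)) / t)) t := by
    intro t ht
    have ht : (0:ℝ) < t := ht
    have h1 : HasDerivAt (fun t : ℝ => Real.exp (-t)) (Real.exp (-t) * (-1)) t := by
      simpa using ((hasDerivAt_id t).neg).exp
    have h2 : HasDerivAt (fun t : ℝ => -(p / t)) (p / t ^ 2) t := by
      have := ((hasDerivAt_const t p).fun_div (hasDerivAt_id' t) ht.ne').fun_neg
      refine this.congr_deriv ?_
      field_simp
      ring
    have h3 : HasDerivAt (fun t : ℝ => Real.exp (-(p / t))) (Real.exp (-(p / t)) * (p / t ^ 2)) t := h2.exp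
    have h4 := h1.fun_mul h3
    have h5 := (hasDerivAt_id' t).fun_mul h4
    refine h5.congr_deriv ?_
    field_simp
    ring
  have hcont : ContinuousWithinAt (fun t : ℝ => t * (Real.exp (-t) * Real.exp (-(p / t)))) (Ici 0) 0 := by
    -- squeeze: 0 ≤ F t ≤ t on [0, ∞)
    have hup : Tendsto (fun t : ℝ => t) (𝓝[Ici 0] 0) (𝓝 0) :=
      (continuous_id.tendsto 0).mono_left nhdsWithin_le_nhds
    have hT : Tendsto (fun t : ℝ => t * (Real.exp (-t) * Real.exp (-(p / t)))) (𝓝[Ici 0] 0) (𝓝 0) := by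
      refine tendsto_of_tendsto_of_tendsto_of_le_of_le' tendsto_const_nhds hup ?_ ?_
      · refine eventually_nhdsWithin_of_forall fun t (ht : 0 ≤ t) => ?_
        positivity
      · refine eventually_nhdsWithin_of_forall fun t (ht : 0 ≤ t) => ?_
        have h1 : Real.exp (-t) ≤ 1 := by rw [Real.exp_le_one_iff]; linarith
        have h2 : Real.exp (-(p / t)) ≤ 1 := by rw [Real.exp_le_one_iff]; exact neg_nonpos.mpr (div_nonneg hp.le ht)
        calc t * (Real.exp (-t) * Real.exp (-(p / t))) ≤ t * (1 * 1) := by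
              gcongr
          _ = t := by ring
    rw [ContinuousWithinAt]
    simpa using hT
  have hlim : Tendsto (fun t : ℝ => t * (Real.exp (-t) * Real.exp (-(p / t)))) atTop (𝓝 0) := by
    have hte : Tendsto (fun t : ℝ => t ^ (1:ℕ) * Real.exp (-t)) atTop (𝓝 0) :=
      Real.tendsto_pow_mul_exp_neg_atTop_nhds_zero 1
    simp only [pow_one] at hte
    refine tendsto_of_tendsto_of_tendsto_of_le_of_le' tendsto_const_nhds hte ?_ ?_
    · filter_upwards [eventually_ge_atTop (0:ℝ)] with t ht
      positivity
    · filter_upwards [eventually_ge_atTop (0:ℝ)] with t ht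
      have h2 : Real.exp (-(p / t)) ≤ 1 := by rw [Real.exp_le_one_iff]; exact neg_nonpos.mpr (div_nonneg hp.le ht)
      calc t * (Real.exp (-t) * Real.exp (-(p / t))) ≤ t * (Real.exp (-t) * 1) := by gcongr
        _ = t * Real.exp (-t) := by ring
  have hI1 : IntegrableOn (fun t : ℝ => Real.exp (-t) * Real.exp (-(p / t))) (Ioi 0) := integrableOn_fC hp.le
  have hI2 := integrableOn_mul_fC hp.le
  have hI3 : IntegrableOn (fun t : ℝ => Real.exp (-t) * Real.exp (-(p / t)) / t) (Ioi 0) := integrableOn_E_integrand hp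
  have hint : IntegrableOn (fun t : ℝ => (Real.exp (-t) * Real.exp (-(p / t)) - t * (Real.exp (-t) * Real.exp (-(p / t))))
        + p * (Real.exp (-t) * Real.exp (-(p / t)) / t)) (Ioi 0) := (hI1.sub' hI2).fun_add (hI3.const_mul p)
  have hFTC := integral_Ioi_of_hasDerivAt_of_tendsto hcont hderiv hint hlim
  have hsplit : ∫ t in Ioi (0:ℝ), ((Real.exp (-t) * Real.exp (-(p / t)) - t * (Real.exp (-t) * Real.exp (-(p / t))))
        + p * (Real.exp (-t) * Real.exp (-(p / t)) / t))
      = ((∫ t in Ioi (0:ℝ), Real.exp (-t) * Real.exp (-(p / t))) - ∫ t in Ioi (0:ℝ), t * (Real.exp (-t) * Real.exp (-(p / t))))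
        + p * ∫ t in Ioi (0:ℝ), Real.exp (-t) * Real.exp (-(p / t)) / t := by
    rw [integral_add (hI1.sub' hI2) (hI3.const_mul p), integral_sub hI1 hI2, integral_const_mul]
  rw [hsplit] at hFTC
  simp only [zero_mul, sub_zero] at hFTC
  unfold Cint Eint
  linarith


/-! ## §2  Γ(5/2)-subordination of `(1+h²)^{-5/2}` -/

/-- `Γ(5/2) = 3√π/4`. [folklore] -/
theorem Gamma_five_halves : Real.Gamma (5 / 2) = 3 * √π / 4 := by
  have h := Real.Gamma_add_one (s := 3 / 2) (by norm_num)
  rw [show (3:ℝ) / 2 + 1 = 5 / 2 by norm_num, Gamma_three_halves] at h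
  rw [h]; ring

/-- SUBORDINATION at order `5/2`: `((1+h²)^{5/2})⁻¹ = Γ(5/2)⁻¹·∫₀^∞ t^{3/2} e^{−(1+h²)t} dt`. [folklore] -/
theorem inv_rpow_five_halves_eq_integral (h : ℝ) :
    ((1 + h ^ 2) ^ (5 / 2 : ℝ))⁻¹
      = (Real.Gamma (5 / 2))⁻¹ * ∫ t in Ioi (0:ℝ), t ^ (3 / 2 : ℝ) * Real.exp (-((1 + h ^ 2) * t)) := by
  have hr : 0 < 1 + h ^ 2 := by positivity
  have key := Real.integral_rpow_mul_exp_neg_mul_Ioi (a := 5 / 2) (r := 1 + h ^ 2) (by norm_num) hr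
  rw [show (5:ℝ) / 2 - 1 = 3 / 2 by norm_num] at key
  rw [key, one_div, Real.inv_rpow hr.le]
  have hG : Real.Gamma (5 / 2) ≠ 0 := (Real.Gamma_pos_of_pos (by norm_num)).ne'
  field_simp

/-- Integrability of `t^{3/2} e^{−(1+h²)t}` on `(0,∞)`. [folklore] -/
theorem integrableOn_rpow_three_halves_mul_exp (h : ℝ) :
    IntegrableOn (fun t : ℝ => t ^ (3 / 2 : ℝ) * Real.exp (-((1 + h ^ 2) * t))) (Ioi 0) := by
  have hr : 0 < 1 + h ^ 2 := by positivity
  have := integrableOn_rpow_mul_exp_neg_mul_rpow (s := 3 / 2) (p := 1) (b := 1 + h ^ 2)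
    (by norm_num) le_rfl hr
  refine this.congr_fun (fun t _ => ?_) measurableSet_Ioi
  simp only [Real.rpow_one, neg_mul]

/-! ## §3  `∫_ℝ cos(xh)(1+h²)^{-5/2} dh = (4/3)·∫₀^∞ t·e^{−t}e^{−x²/(4t)} dt` -/

/-- Continuity of the order-`5/2` subordinated integrand. [folklore] -/
theorem continuous_cosSubordinand5 (x : ℝ) : Continuous (fun p : ℝ × ℝ => Real.cos (x * p.1)
    * ((Real.Gamma (5 / 2))⁻¹ * (p.2 ^ (3 / 2 : ℝ) * Real.exp (-((1 + p.1 ^ 2) * p.2))))) := by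
  have hr : Continuous fun p : ℝ × ℝ => p.2 ^ (3 / 2 : ℝ) :=
    (Real.continuous_rpow_const (by norm_num)).comp continuous_snd
  fun_prop

/-- Integrability of the order-`5/2` subordinated cosine integrand on `ℝ × (0,∞)` (norm slice
`|cos(xh)|(1+h²)^{−5/2} ≤ (1+h²)⁻¹`). [folklore] -/
theorem integrable_cosSubordinand5 (x : ℝ) :
    Integrable (fun p : ℝ × ℝ => Real.cos (x * p.1)
      * ((Real.Gamma (5 / 2))⁻¹ * (p.2 ^ (3 / 2 : ℝ) * Real.exp (-((1 + p.1 ^ 2) * p.2)))))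
      ((volume : Measure ℝ).prod (volume.restrict (Ioi (0:ℝ)))) := by
  have hmeas : AEStronglyMeasurable (fun p : ℝ × ℝ => Real.cos (x * p.1)
      * ((Real.Gamma (5 / 2))⁻¹ * (p.2 ^ (3 / 2 : ℝ) * Real.exp (-((1 + p.1 ^ 2) * p.2)))))
      ((volume : Measure ℝ).prod (volume.restrict (Ioi (0:ℝ)))) :=
    (continuous_cosSubordinand5 x).aestronglyMeasurable
  rw [integrable_prod_iff hmeas]
  constructor
  · refine Filter.Eventually.of_forall fun h => ?_
    exact ((integrableOn_rpow_three_halves_mul_exp h).const_mul ((Real.Gamma (5 / 2))⁻¹)).const_mul (Real.cos (x * h))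
  · have hnorm : ∀ h : ℝ, ∫ t in Ioi (0:ℝ), ‖(fun p : ℝ × ℝ => Real.cos (x * p.1)
      * ((Real.Gamma (5 / 2))⁻¹ * (p.2 ^ (3 / 2 : ℝ) * Real.exp (-((1 + p.1 ^ 2) * p.2))))) (h, t)‖
        = |Real.cos (x * h)| * ((1 + h ^ 2) ^ (5 / 2 : ℝ))⁻¹ := by
      intro h
      have hG : 0 < (Real.Gamma (5 / 2))⁻¹ := inv_pos.mpr (Real.Gamma_pos_of_pos (by norm_num))
      have hpt : ∀ t ∈ Ioi (0:ℝ), ‖(fun p : ℝ × ℝ => Real.cos (x * p.1)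
          * ((Real.Gamma (5 / 2))⁻¹ * (p.2 ^ (3 / 2 : ℝ) * Real.exp (-((1 + p.1 ^ 2) * p.2))))) (h, t)‖
            = |Real.cos (x * h)| * ((Real.Gamma (5 / 2))⁻¹ * (t ^ (3 / 2 : ℝ) * Real.exp (-((1 + h ^ 2) * t)))) := by
        intro t ht
        simp only [Real.norm_eq_abs, abs_mul]
        rw [abs_of_pos hG, abs_of_nonneg (Real.rpow_nonneg (le_of_lt ht) _), abs_of_pos (Real.exp_pos _)]
      rw [setIntegral_congr_fun measurableSet_Ioi hpt, integral_const_mul, integral_const_mul,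
        inv_rpow_five_halves_eq_integral h]
    simp_rw [hnorm]
    have hdom : Integrable (fun h : ℝ => (1 + h ^ 2)⁻¹) (volume : Measure ℝ) := integrable_inv_one_add_sq
    refine hdom.mono' ?_ ?_
    · refine ((Continuous.abs ?_).mul ?_).aestronglyMeasurable
      · exact Real.continuous_cos.comp (continuous_const.mul continuous_id)
      · refine Continuous.inv₀ ?_ (fun h => (Real.rpow_pos_of_pos (by positivity) _).ne')
        exact (continuous_const.add (continuous_pow 2)).rpow_const fun _ => Or.inr (by norm_num)
    · refine Filter.Eventually.of_forall fun h => ?_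
      have hpos : 0 < 1 + h ^ 2 := by positivity
      have h1 : 1 ≤ 1 + h ^ 2 := by nlinarith
      rw [Real.norm_eq_abs, abs_mul, abs_abs, abs_of_pos (inv_pos.mpr (Real.rpow_pos_of_pos hpos _))]
      have hpow : 1 + h ^ 2 ≤ (1 + h ^ 2) ^ (5 / 2 : ℝ) := by
        have := Real.rpow_le_rpow_of_exponent_le h1 (show (1:ℝ) ≤ 5 / 2 by norm_num)
        rwa [Real.rpow_one] at this
      have hinv : ((1 + h ^ 2) ^ (5 / 2 : ℝ))⁻¹ ≤ (1 + h ^ 2)⁻¹ := inv_anti₀ hpos hpow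
      calc |Real.cos (x * h)| * ((1 + h ^ 2) ^ (5 / 2 : ℝ))⁻¹ ≤ 1 * (1 + h ^ 2)⁻¹ := by
            gcongr; exact Real.abs_cos_le_one _
        _ = (1 + h ^ 2)⁻¹ := one_mul _

/-- For `t > 0`: `Γ(5/2)⁻¹·t^{3/2}e^{−t}·√(π/t)e^{−x²/(4t)} = (4/3)·t·e^{−t}e^{−(x²/4)/t}`. [folklore] -/
theorem subordination_weight5_eq {t : ℝ} (ht : 0 < t) (x : ℝ) :
    (Real.Gamma (5 / 2))⁻¹ * (t ^ (3 / 2 : ℝ) * Real.exp (-t)) * (√(π / t) * Real.exp (-x ^ 2 / (4 * t)))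
      = 4 / 3 * (t * (Real.exp (-t) * Real.exp (-((x ^ 2 / 4) / t)))) := by
  rw [Gamma_five_halves]
  have h32 : t ^ (3 / 2 : ℝ) = t * √t := by
    rw [show (3 / 2 : ℝ) = 1 + 1 / 2 by norm_num, Real.rpow_add ht, Real.rpow_one, Real.sqrt_eq_rpow]
  have hpi : 0 < π := Real.pi_pos
  have h1 : √(π / t) = √π / √t := Real.sqrt_div (le_of_lt hpi) t
  have hst : 0 < √t := Real.sqrt_pos.mpr ht
  have hsp : 0 < √π := Real.sqrt_pos.mpr hpi
  have hx : -x ^ 2 / (4 * t) = -((x ^ 2 / 4) / t) := by field_simp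
  rw [h32, h1, hx]
  field_simp

/-- **Cosine transform of `(1+h²)^{-5/2}`**: `∫_ℝ cos(xh)(1+h²)^{−5/2} dh = (4/3)·∫₀^∞ t·e^{−t}e^{−x²/(4t)} dt`
(`= (4/3)·C₂(x²/4)`, `C₂(p) = 2pK₂(2√p)`). [folklore; Watson §6.16] -/
theorem integral_cos_mul_inv_rpow_five_halves (x : ℝ) :
    ∫ h : ℝ, Real.cos (x * h) * ((1 + h ^ 2) ^ (5 / 2 : ℝ))⁻¹
      = 4 / 3 * ∫ t in Ioi (0:ℝ), t * (Real.exp (-t) * Real.exp (-((x ^ 2 / 4) / t))) := by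
  have hL : ∫ h : ℝ, Real.cos (x * h) * ((1 + h ^ 2) ^ (5 / 2 : ℝ))⁻¹
      = ∫ h : ℝ, ∫ t in Ioi (0:ℝ), (fun p : ℝ × ℝ => Real.cos (x * p.1)
          * ((Real.Gamma (5 / 2))⁻¹ * (p.2 ^ (3 / 2 : ℝ) * Real.exp (-((1 + p.1 ^ 2) * p.2))))) (h, t) := by
    refine integral_congr_ae (Filter.Eventually.of_forall fun h => ?_)
    simp only []
    rw [integral_const_mul, integral_const_mul, inv_rpow_five_halves_eq_integral h]
  have hint : Integrable (Function.uncurry fun h t => (fun p : ℝ × ℝ => Real.cos (x * p.1)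
      * ((Real.Gamma (5 / 2))⁻¹ * (p.2 ^ (3 / 2 : ℝ) * Real.exp (-((1 + p.1 ^ 2) * p.2))))) (h, t))
      ((volume : Measure ℝ).prod (volume.restrict (Ioi (0:ℝ)))) := integrable_cosSubordinand5 x
  have hswap := integral_integral_swap hint
  rw [hL, hswap]
  have hinner : ∀ t ∈ Ioi (0:ℝ), (∫ h : ℝ, (fun p : ℝ × ℝ => Real.cos (x * p.1)
      * ((Real.Gamma (5 / 2))⁻¹ * (p.2 ^ (3 / 2 : ℝ) * Real.exp (-((1 + p.1 ^ 2) * p.2))))) (h, t))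
        = 4 / 3 * (t * (Real.exp (-t) * Real.exp (-((x ^ 2 / 4) / t)))) := by
    intro t ht
    have ht : (0:ℝ) < t := ht
    have hrw : ∀ h : ℝ, (fun p : ℝ × ℝ => Real.cos (x * p.1)
        * ((Real.Gamma (5 / 2))⁻¹ * (p.2 ^ (3 / 2 : ℝ) * Real.exp (-((1 + p.1 ^ 2) * p.2))))) (h, t)
          = ((Real.Gamma (5 / 2))⁻¹ * (t ^ (3 / 2 : ℝ) * Real.exp (-t)))
            * (Real.cos (x * h) * Real.exp (-t * h ^ 2)) := by
      intro h
      simp only []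
      have : Real.exp (-((1 + h ^ 2) * t)) = Real.exp (-t) * Real.exp (-t * h ^ 2) := by
        rw [← Real.exp_add]; congr 1; ring
      rw [this]; ring
    simp_rw [hrw]
    rw [integral_const_mul, integral_cos_mul_exp_neg_mul_sq ht x, subordination_weight5_eq ht x]
  rw [setIntegral_congr_fun measurableSet_Ioi hinner, integral_const_mul]

/-! ## §4  Closed form and bound: `∫_ℝ cos(xh)(1+h²)^{-5/2} dh = (4/3)(C + pE)(x²/4) ≤ (4/3)(1 + x/2)(1+x)e^{−x}` -/

/-- `∫₀^∞ t·e^{−t} dt = 1` (`= Γ(2)`). [folklore] -/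
theorem integral_Ioi_mul_exp_neg : ∫ t in Ioi (0:ℝ), t * Real.exp (-t) = 1 := by
  have key := Real.integral_rpow_mul_exp_neg_mul_Ioi (a := 2) (r := 1) (by norm_num) one_pos
  have h2 : Real.Gamma 2 = 1 := by
    rw [show (2:ℝ) = 1 + 1 by norm_num, Real.Gamma_add_one one_ne_zero, Real.Gamma_one]; norm_num
  rw [h2, show (2:ℝ) - 1 = 1 by norm_num] at key
  have : ∀ t ∈ Ioi (0:ℝ), t ^ (1:ℝ) * Real.exp (-(1 * t)) = t * Real.exp (-t) := by
    intro t _; simp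
  rw [setIntegral_congr_fun measurableSet_Ioi this] at key
  rw [key]; norm_num

/-- **Bound for the order-`5/2` cosine transform** (`x ≥ 0`):
`0 ≤ ∫_ℝ cos(xh)(1+h²)^{−5/2} dh ≤ (4/3)·(1 + x/2)·(1 + x)·e^{−x}` (value `(4/3)(C(p) + pE(p))`, `p = x²/4`, and
`pE ≤ √p·C`, `C ≤ (1+2√p)e^{−2√p}`). [folklore] -/
theorem abs_integral_cos_mul_inv_rpow_five_halves_le {x : ℝ} (hx : 0 ≤ x) :
    |∫ h : ℝ, Real.cos (x * h) * ((1 + h ^ 2) ^ (5 / 2 : ℝ))⁻¹| ≤ 4 / 3 * (1 + x / 2) * (1 + x) * Real.exp (-x) := by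
  rw [integral_cos_mul_inv_rpow_five_halves x]
  rcases hx.eq_or_lt with h0 | hxpos
  · subst h0
    have hz : ∫ t in Ioi (0:ℝ), t * (Real.exp (-t) * Real.exp (-(((0:ℝ) ^ 2 / 4) / t))) = 1 := by
      have : ∀ t ∈ Ioi (0:ℝ), t * (Real.exp (-t) * Real.exp (-(((0:ℝ) ^ 2 / 4) / t))) = t * Real.exp (-t) := by
        intro t _; simp
      rw [setIntegral_congr_fun measurableSet_Ioi this, integral_Ioi_mul_exp_neg]
    rw [hz]; norm_num
  have hp : 0 < x ^ 2 / 4 := by positivity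
  have hroot : √(x ^ 2 / 4) = x / 2 := by
    rw [show x ^ 2 / 4 = (x / 2) ^ 2 by ring]; exact Real.sqrt_sq (by linarith)
  rw [integral_mul_fC_eq hp]
  have h1 := sqrt_mul_Eint_le_Cint hp
  have h2 := Cint_le_sharp hp.le
  rw [hroot] at h1 h2
  have hC0 := Cint_nonneg (x ^ 2 / 4)
  have hE0 := Eint_nonneg (x ^ 2 / 4)
  have hval : 0 ≤ Cint (x ^ 2 / 4) + x ^ 2 / 4 * Eint (x ^ 2 / 4) := by positivity
  rw [abs_of_nonneg (by positivity)]
  -- `p E = (x/2)·((x/2) E) ≤ (x/2)·C`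
  have hpE : x ^ 2 / 4 * Eint (x ^ 2 / 4) ≤ x / 2 * Cint (x ^ 2 / 4) := by
    have := mul_le_mul_of_nonneg_left h1 (by linarith : 0 ≤ x / 2)
    calc x ^ 2 / 4 * Eint (x ^ 2 / 4) = x / 2 * (x / 2 * Eint (x ^ 2 / 4)) := by ring
      _ ≤ x / 2 * Cint (x ^ 2 / 4) := this
  calc 4 / 3 * (Cint (x ^ 2 / 4) + x ^ 2 / 4 * Eint (x ^ 2 / 4))
      ≤ 4 / 3 * (Cint (x ^ 2 / 4) + x / 2 * Cint (x ^ 2 / 4)) := by linarith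
    _ = 4 / 3 * (1 + x / 2) * Cint (x ^ 2 / 4) := by ring
    _ ≤ 4 / 3 * (1 + x / 2) * ((1 + 2 * (x / 2)) * Real.exp (-(2 * (x / 2)))) :=
        mul_le_mul_of_nonneg_left h2 (by positivity)
    _ = 4 / 3 * (1 + x / 2) * (1 + x) * Real.exp (-x) := by ring_nf

/-! ## §5  Scaling and the census-style statement for the kernel-gradient entry -/

/-- `((D h)² + D²)^{5/2} = D⁵·(1+h²)^{5/2}` for `D > 0`. [folklore] -/
theorem rpow_scale5 {D : ℝ} (hD : 0 < D) (h : ℝ) :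
    ((D * h) ^ 2 + D ^ 2) ^ (5 / 2 : ℝ) = D ^ 5 * (1 + h ^ 2) ^ (5 / 2 : ℝ) := by
  have h1 : (D * h) ^ 2 + D ^ 2 = D ^ 2 * (1 + h ^ 2) := by ring
  have h2 : (D ^ 2) ^ (5 / 2 : ℝ) = D ^ 5 := by
    rw [← Real.rpow_natCast D 2, ← Real.rpow_mul hD.le, show ((2:ℕ):ℝ) * (5 / 2 : ℝ) = ((5:ℕ):ℝ) by norm_num,
      Real.rpow_natCast]
  rw [h1, Real.mul_rpow (by positivity) (by positivity), h2]

/-- **Scaled order-`5/2` symbol bound**: for `D > 0`, `k ≥ 0`,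
`|∫_ℝ cos(kσ)(σ²+D²)^{−5/2} dσ| ≤ (4/3)·D⁻⁴·(1 + kD/2)(1 + kD)·e^{−kD}`. [folklore] -/
theorem abs_integral_cos_mul_inv_rpow_five_halves_scale_le {D k : ℝ} (hD : 0 < D) (hk : 0 ≤ k) :
    |∫ σ : ℝ, Real.cos (k * σ) * ((σ ^ 2 + D ^ 2) ^ (5 / 2 : ℝ))⁻¹|
      ≤ 4 / 3 * (D ^ 4)⁻¹ * (1 + k * D / 2) * (1 + k * D) * Real.exp (-(k * D)) := by
  have hsub := MeasureTheory.Measure.integral_comp_mul_left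
    (fun σ : ℝ => Real.cos (k * σ) * ((σ ^ 2 + D ^ 2) ^ (5 / 2 : ℝ))⁻¹) D
  have hD0 : D ≠ 0 := hD.ne'
  have habs : |D⁻¹| = D⁻¹ := abs_of_pos (inv_pos.mpr hD)
  rw [habs, smul_eq_mul] at hsub
  have hg : ∀ h : ℝ, Real.cos (k * (D * h)) * (((D * h) ^ 2 + D ^ 2) ^ (5 / 2 : ℝ))⁻¹
      = (D ^ 5)⁻¹ * (Real.cos ((k * D) * h) * ((1 + h ^ 2) ^ (5 / 2 : ℝ))⁻¹) := by
    intro h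
    rw [rpow_scale5 hD h, mul_inv, show k * (D * h) = (k * D) * h by ring]
    ring
  simp_rw [hg] at hsub
  rw [integral_const_mul] at hsub
  set A := ∫ h : ℝ, Real.cos ((k * D) * h) * ((1 + h ^ 2) ^ (5 / 2 : ℝ))⁻¹ with hA
  set G := ∫ σ : ℝ, Real.cos (k * σ) * ((σ ^ 2 + D ^ 2) ^ (5 / 2 : ℝ))⁻¹ with hG
  have hGA : G = (D ^ 4)⁻¹ * A := by
    have h' : G = D * ((D ^ 5)⁻¹ * A) := by rw [hsub]; field_simp
    rw [h']; field_simp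
  rw [hGA, abs_mul, abs_of_pos (by positivity : (0:ℝ) < (D ^ 4)⁻¹)]
  have hb := abs_integral_cos_mul_inv_rpow_five_halves_le (show 0 ≤ k * D by positivity)
  calc (D ^ 4)⁻¹ * |A| ≤ (D ^ 4)⁻¹ * (4 / 3 * (1 + k * D / 2) * (1 + k * D) * Real.exp (-(k * D))) :=
        mul_le_mul_of_nonneg_left hb (by positivity)
    _ = 4 / 3 * (D ^ 4)⁻¹ * (1 + k * D / 2) * (1 + k * D) * Real.exp (-(k * D)) := by ring

/-- **(R♯-sw), kernel-gradient entry** — companion of `swirlBand_decoupling` for the `∇`-kernel power: for `0 < μ ≤ d`,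
`k ≥ 0`, `|∫ cos(kσ)((d²+σ²)+μ²)^{−5/2} dσ| ≤ (4/3)(d²+μ²)⁻²(1 + k√(d²+μ²)/2)(1 + k√(d²+μ²))e^{−k√(d²+μ²)}`; the entries
`σ²((d²+σ²)+μ²)^{−5/2} = ((d²+σ²)+μ²)^{−3/2} − (d²+μ²)((d²+σ²)+μ²)^{−5/2}` follow by linearity. [folklore] -/
theorem swirlBand_decoupling_grad : ∀ (d μ k : ℝ), 0 < μ → μ ≤ d → 0 ≤ k →
    |∫ σ, Real.cos (k * σ) * ((d ^ 2 + σ ^ 2) + μ ^ 2) ^ (-(5:ℝ) / 2)|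
      ≤ 4 / 3 * ((d ^ 2 + μ ^ 2) ^ 2)⁻¹ * (1 + k * √(d ^ 2 + μ ^ 2) / 2) * (1 + k * √(d ^ 2 + μ ^ 2))
        * Real.exp (-k * √(d ^ 2 + μ ^ 2)) := by
  intro d μ k hμ _ hk
  have hD2 : 0 < d ^ 2 + μ ^ 2 := by positivity
  have hD : 0 < √(d ^ 2 + μ ^ 2) := Real.sqrt_pos.mpr hD2
  have hsq : √(d ^ 2 + μ ^ 2) ^ 2 = d ^ 2 + μ ^ 2 := Real.sq_sqrt hD2.le
  have hfun : (fun σ : ℝ => Real.cos (k * σ) * ((d ^ 2 + σ ^ 2) + μ ^ 2) ^ (-(5:ℝ) / 2))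
      = fun σ : ℝ => Real.cos (k * σ) * ((σ ^ 2 + √(d ^ 2 + μ ^ 2) ^ 2) ^ (5 / 2 : ℝ))⁻¹ := by
    funext σ
    rw [hsq, show (d ^ 2 + σ ^ 2) + μ ^ 2 = σ ^ 2 + (d ^ 2 + μ ^ 2) by ring,
      show (-(5:ℝ) / 2) = -(5 / 2 : ℝ) by norm_num, Real.rpow_neg (by positivity)]
  rw [hfun]
  have h := abs_integral_cos_mul_inv_rpow_five_halves_scale_le hD hk
  have h4 : √(d ^ 2 + μ ^ 2) ^ 4 = (d ^ 2 + μ ^ 2) ^ 2 := by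
    rw [show (4:ℕ) = 2 * 2 by norm_num, pow_mul, hsq]
  rw [h4, ← neg_mul] at h
  exact h

end Summit.NavierStokesRegularity.NavierStokesRegularity.Theorems.TangentSkeletonNearStraightLSwirlBand
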